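import Literature.Barriers.Parity.SiegelZeroPrimePairsProofs
import HarnessLib

/-!
# Matomäki–Merikoski Corollary 1.1(ii) from the CLASSICAL form of Theorem 1.3, proved

Sibling of `Literature/Barriers/Parity/SiegelZeroPrimePairs.lean` (the catalogue entry vendoring
Matomäki–Merikoski, *Siegel zeros, twin primes, Goldbach's conjecture, and primes in short
intervals* (IMRN 2023; arXiv:2112.11412), Theorem 1.3 as the named fact
`Literature.Barriers.Parity.MatomakiMerikoski2023_pairCorrelation` and Corollary 1.1(ii) as the named
fact `Literature.Barriers.Parity.MatomakiMerikoski2023_fixedShift_ii`), of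
`Literature/Barriers/Parity/SiegelZeroPrimePairsProofs.lean` (the deduction
`MatomakiMerikoski2023_pairCorrelation → MatomakiMerikoski2023_fixedShift_ii`, proved, and the conductor
lemmas `Literature.Barriers.Parity.SiegelCorr.*` reused here) and of
`Literature/Barriers/Parity/SiegelZeroPrimePairsFixedShift.lean` (the same for Corollary 1.1(i),
including its deduction from the CLASSICAL form of Theorem 1.3,
`MatomakiMerikoski2023_fixedShift_of_pairCorrelation_classical`). Everything here is PROVED; no
definition and no named fact is introduced.

The source deduces Corollary 1.1(ii) from Theorem 1.3 in two lines (arXiv p. 4, after Theorem 1.4):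
"by Siegel's theorem `η ≪_ε q^ε`. For `X ≥ q^{10 log η}` the quantity
`1/η = exp(−log η) ≫ exp(−√((log q)(log η))) ≫ exp(−√log X)` dominates `exp(−C(log X)^{3/5−ε})`
and `exp(−C V √log η)`, so also Corollary 1.1(ii) follows from Theorem 1.3." As the display shows,
the deduction uses the second error term of Theorem 1.3 only through the CLASSICAL rate
`exp(−√log X)`: the Vinogradov–Korobov strength `exp(−C (log X)^{3/5−ε})` is not needed. This file
records that observation as theorems, so that EITHER form of Theorem 1.3 discharges Corollary 1.1(ii):

* `MatomakiMerikoski2023_fixedShift_ii_of_weakPairCorrelation` — Corollary 1.1(ii) from the weakest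
  form of Theorem 1.3 that the printed deduction uses: ONE value `C = 1` of the first rate
  `exp(−√(V log η))`, the classical second rate `exp(−c₀ √log X)` for SOME fixed `c₀ > 0`, and the
  third rate `V log⁶η/η`, for positive shifts `h ≤ A X` (**proved**). With `L = log η`, `ℓ = log q`,
  `log X = V ℓ ≥ 10 L ℓ` and Siegel's theorem in the tree's PROVED form
  `Literature.NumberTheory.LFunctions.Siegel.exists_one_sub_realZero_ge` (Montgomery–Vaughan Cor. 11.15)
  at the exponent `ε_S = min(1/4, c₀²)`: `η ≤ D q^{ε_S}`, `D = 1/(C(ε_S) log 2)`, so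
  `L ≤ |log D| + ε_S ℓ`; if `L ≥ 2|log D| + 1` then `ε_S ℓ ≥ L/2`, `c₀² V ℓ ≥ 10 L ε_S ℓ ≥ 5L²`, hence
  `exp(−c₀√log X) ≤ e^{−L} = 1/η`; otherwise `η ≤ e^{2|log D|+1}` and `exp(−c₀ √log X) ≤ 1 ≤
  e^{2|log D|+1}/η`. The first rate is `≤ 1/η` because `V ≥ 10 L ≥ L`, and `1/η ≤ V L⁶/η`, the
  target rate. The correction factor of Theorem 1.3 (absent from the corollary) is
  `≤ √(24h/q)` (`SiegelCorr.abs_corr_le`: the odd part of the conductor of a primitive quadratic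
  character is squarefree and its `2`-part divides `8`) and `1/√q ≤ D²/η` (`η ≤ D q^{1/4}`), which is
  absorbed in `O_h(X V L⁶/η)` as in `SiegelZeroPrimePairsProofs.lean`. The upper constraint
  `V ≤ η^{1−ε}` of the corollary is not used (it only keeps the error term `o(X)`).
* `MatomakiMerikoski2023_fixedShift_ii_of_pairCorrelation_classical` — Corollary 1.1(ii) from the
  classical form of Theorem 1.3 in exactly the shape used for Corollary 1.1(i) in
  `MatomakiMerikoski2023_fixedShift_of_pairCorrelation_classical` (hypothesis `h13` there: all `C ≥ 1`,
  second rate `exp(−c₀ √log X)`), so that one proof of that shape — Theorem 1.3 assembled from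
  Lemma 2.4 with the classical zero-free region, `SiegelZeroPrimePairsLemma24.lean` — closes both
  corollaries (**proved**, specialisation `C = 1`).
* `MatomakiMerikoski2023_pairCorrelation.weakPairCorrelation` — the vendored (Vinogradov–Korobov) form
  of Theorem 1.3 implies the weak form with `c₀ = 1` (`C = 1`, `ε = 1/10`:
  `(log X)^{3/5−1/10} = √log X`) (**proved**); composing it with the first theorem re-derives
  `MatomakiMerikoski2023_fixedShift_ii_of_pairCorrelation` (`SiegelZeroPrimePairsProofs.lean`), so the
  three routes are consistent.

## References

* K. Matomäki, J. Merikoski, *Siegel zeros, twin primes, Goldbach's conjecture, and primes in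
  short intervals*, IMRN 2023:23, 20337–20384 (arXiv:2112.11412): Corollary 1.1(ii), Theorem 1.3 and
  the deduction printed after Theorem 1.4 (arXiv p. 4). [cite: MatomakiMerikoski2023, Corollary 1.1(ii)]
* H. L. Montgomery, R. C. Vaughan, *Multiplicative Number Theory I*, Cambridge 2007, Cor. 11.15
  (Siegel's theorem for real zeros; tree:
  `Literature.NumberTheory.LFunctions.Siegel.exists_one_sub_realZero_ge`).
  [cite: MontgomeryVaughan2007, Corollary 11.15]
-/

noncomputable section

open Finset Real
open scoped ArithmeticFunction.vonMangoldt

namespace Literature.Barriers.Parity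

namespace MatomakiMerikoski

/-- **The classical rate against the Siegel quality.** If `log η ≤ M + ε_S log q` (Siegel's theorem),
`ε_S ≤ c₀²`, `V ≥ 10 log η` and `log η ≥ 2M + 1` (`M ≥ 0`), then
`exp(−c₀ √(V log q)) ≤ 1/η`: indeed `ε_S log q ≥ log η/2`, so
`c₀² V log q ≥ 10 log η · ε_S log q ≥ 5 log²η ≥ log²η`. [cite: MatomakiMerikoski2023, proof of
Corollary 1.1(ii) after Theorem 1.4: "`1/η = exp(−log η) ≫ exp(−√((log q)(log η))) ≫ exp(−√log X)`"] -/
theorem exp_neg_mul_sqrt_le_inv {c₀ εS M ℓ L V η : ℝ} (hc₀ : 0 < c₀) (hεc : εS ≤ c₀ ^ 2)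
    (hM : 0 ≤ M) (hℓ : 0 ≤ ℓ) (hη : 0 < η) (hL : L = Real.log η) (hLle : L ≤ M + εS * ℓ)
    (hLbig : 2 * M + 1 ≤ L) (hV : 10 * L ≤ V) :
    Real.exp (-c₀ * Real.sqrt (V * ℓ)) ≤ 1 / η := by
  have hL0 : 0 < L := by linarith
  have hεℓ : L / 2 ≤ εS * ℓ := by linarith
  have hV0 : 0 ≤ V := by linarith
  -- `L² ≤ c₀² V ℓ`
  have hsq : L ^ 2 ≤ c₀ ^ 2 * (V * ℓ) := by
    have h1 : c₀ ^ 2 * (V * ℓ) ≥ V * (εS * ℓ) := by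
      have : εS * ℓ ≤ c₀ ^ 2 * ℓ := mul_le_mul_of_nonneg_right hεc hℓ
      nlinarith
    have h2 : V * (εS * ℓ) ≥ 10 * L * (L / 2) := by
      have hεℓ0 : 0 ≤ εS * ℓ := le_trans (by linarith) hεℓ
      exact mul_le_mul hV hεℓ (by linarith) hV0
    nlinarith
  have hLle' : L ≤ c₀ * Real.sqrt (V * ℓ) := by
    calc L = Real.sqrt (L ^ 2) := (Real.sqrt_sq hL0.le).symm
      _ ≤ Real.sqrt (c₀ ^ 2 * (V * ℓ)) := Real.sqrt_le_sqrt hsq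
      _ = c₀ * Real.sqrt (V * ℓ) := by
          rw [Real.sqrt_mul (sq_nonneg c₀), Real.sqrt_sq hc₀.le]
  rw [one_div, ← Real.exp_log hη, ← Real.exp_neg, ← hL]
  exact Real.exp_le_exp.mpr (by linarith)

/-- **`exp(−c₀ √log X) ≪ 1/η` in the range of Corollary 1.1(ii).** With `log η ≤ M + ε_S log q`
(Siegel), `ε_S ≤ c₀²`, `M ≥ 0`, `log q ≥ 0` and `V ≥ 10 log η`:
`exp(−c₀ √(V log q)) ≤ e^{2M+1}/η` (the previous lemma when `log η ≥ 2M + 1`; otherwise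
`η ≤ e^{2M+1}` and the left side is `≤ 1`). [cite: MatomakiMerikoski2023, proof of Corollary 1.1(ii)] -/
theorem exp_neg_mul_sqrt_le_exp_div {c₀ εS M ℓ V η : ℝ} (hc₀ : 0 < c₀) (hεc : εS ≤ c₀ ^ 2)
    (hM : 0 ≤ M) (hℓ : 0 ≤ ℓ) (hη : 0 < η) (hLle : Real.log η ≤ M + εS * ℓ)
    (hV : 10 * Real.log η ≤ V) :
    Real.exp (-c₀ * Real.sqrt (V * ℓ)) ≤ Real.exp (2 * M + 1) / η := by
  rcases le_or_gt (2 * M + 1) (Real.log η) with hbig | hsmall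
  · have h1 := exp_neg_mul_sqrt_le_inv hc₀ hεc hM hℓ hη rfl hLle hbig hV
    calc Real.exp (-c₀ * Real.sqrt (V * ℓ)) ≤ 1 / η := h1
      _ ≤ Real.exp (2 * M + 1) / η :=
          div_le_div_of_nonneg_right (Real.one_le_exp (by linarith)) hη.le
  · have hηle : η ≤ Real.exp (2 * M + 1) := by
      rw [← Real.exp_log hη]; exact Real.exp_le_exp.mpr hsmall.le
    have h1 : Real.exp (-c₀ * Real.sqrt (V * ℓ)) ≤ 1 := by
      rw [Real.exp_le_one_iff, neg_mul, neg_nonpos]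
      exact mul_nonneg hc₀.le (Real.sqrt_nonneg _)
    calc Real.exp (-c₀ * Real.sqrt (V * ℓ)) ≤ 1 := h1
      _ ≤ Real.exp (2 * M + 1) / η := by rw [le_div_iff₀ hη, one_mul]; exact hηle

end MatomakiMerikoski

set_option maxHeartbeats 800000 in
/-- **Matomäki–Merikoski 2023, Corollary 1.1(ii) from the weak (classical, `C = 1`) form of
Theorem 1.3** (the printed deduction, arXiv p. 4 after Theorem 1.4: "by Siegel's theorem
`η ≪_ε q^ε`. For `X ≥ q^{10 log η}` the quantity
`1/η = exp(−log η) ≫ exp(−√((log q)(log η))) ≫ exp(−√log X)` dominates `exp(−C(log X)^{3/5−ε})`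
and `exp(−C V √log η)`, so also Corollary 1.1(ii) follows from Theorem 1.3"). The hypothesis is
Theorem 1.3 for positive shifts `h ≤ A X` with ONLY `C = 1` in the first rate and the classical
second rate `exp(−c₀ √log X)` for one fixed `c₀ > 0` — implied both by the vendored
Vinogradov–Korobov form (`MatomakiMerikoski2023_pairCorrelation.weakPairCorrelation`) and by the
classical form used for Corollary 1.1(i) (`MatomakiMerikoski2023_fixedShift_ii_of_pairCorrelation_classical`).
Siegel's theorem is the tree's `Literature.NumberTheory.LFunctions.Siegel.exists_one_sub_realZero_ge`
(Montgomery–Vaughan Cor. 11.15) at the exponent `min(1/4, c₀²)`; the correction factor of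
Theorem 1.3 is `≤ √(24h/q) ≤ √(24h) D²/η` (`SiegelCorr.abs_corr_le`).
[cite: MatomakiMerikoski2023, Corollary 1.1(ii) and its proof after Theorem 1.4] -/
theorem MatomakiMerikoski2023_fixedShift_ii_of_weakPairCorrelation {c₀ : ℝ} (hc₀ : 0 < c₀)
    (h13 : ∀ A : ℝ, 0 < A → ∃ K : ℝ, 0 < K ∧
      ∀ (q : ℕ) [NeZero q], 2 ≤ q → ∀ χ : DirichletCharacter ℂ q, χ.IsPrimitive → χ.IsQuadratic →
        ∀ η : ℝ, 10 ≤ η → χ.LFunction ((1 - 1 / (η * Real.log q) : ℝ) : ℂ) = 0 →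
          ∀ V X : ℝ, 10 ≤ V → X = (q : ℝ) ^ V → ∀ h : ℕ, 1 ≤ h → (h : ℝ) ≤ A * X →
            |(∑ n ∈ Icc 1 ⌊X⌋₊, Λ n * Λ (n + h)) -
                X * Literature.NumberTheory.Sieve.goldbachSingularSeries h *
                  (1 + if Nat.totient (2 ^ padicValNat 2 q) ∣ h then
                        (-1 : ℝ) ^ (h / Nat.totient (2 ^ padicValNat 2 q)) *
                          ∏ p ∈ (q / 2 ^ padicValNat 2 q).primeFactors.filter (fun p => ¬ p ∣ h),
                            (-1 : ℝ) / ((p : ℝ) - 2)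
                      else 0)| ≤
              K * ((h : ℝ) / (Nat.totient h : ℝ)) * X *
                (Real.exp (-1 * Real.sqrt (V * Real.log η)) +
                  Real.exp (-c₀ * Real.sqrt (Real.log X)) +
                  V * Real.log η ^ (6 : ℕ) / η)) :
    MatomakiMerikoski2023_fixedShift_ii := by
  intro h hh ε _hε
  -- Siegel's theorem (MV Cor. 11.15) with exponent `ε_S = min(1/4, c₀²)`
  set εS : ℝ := min (1 / 4) (c₀ ^ 2) with hεSdef
  have hεS : 0 < εS := lt_min (by norm_num) (by positivity)
  have hεS4 : εS ≤ 1 / 4 := min_le_left _ _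
  have hεSc : εS ≤ c₀ ^ 2 := min_le_right _ _
  obtain ⟨CS, hCS, hSiegel⟩ :=
    Literature.NumberTheory.LFunctions.Siegel.exists_one_sub_realZero_ge hεS
  have hlog2 : 0 < Real.log 2 := Real.log_pos one_lt_two
  set D : ℝ := 1 / (CS * Real.log 2) with hDdef
  have hD : 0 < D := by positivity
  set M : ℝ := |Real.log D| with hMdef
  have hM : 0 ≤ M := abs_nonneg _
  set K₀ : ℝ := Real.exp (2 * M + 1) with hK₀def
  have hK₀ : 0 < K₀ := Real.exp_pos _
  -- the weak Theorem 1.3 with `A = h`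
  have hh0 : (0 : ℝ) < h := by exact_mod_cast hh
  obtain ⟨K₁, hK₁, h13'⟩ := h13 h hh0
  have htot : (0 : ℝ) < (Nat.totient h : ℝ) := by exact_mod_cast Nat.totient_pos.mpr hh
  set G : ℝ := Literature.NumberTheory.Sieve.goldbachSingularSeries h with hGdef
  refine ⟨K₁ * ((h : ℝ) / (Nat.totient h : ℝ)) * (2 + K₀ + D ^ 2) + |G| * Real.sqrt (24 * h) * D ^ 2,
    by positivity, ?_⟩
  intro q _ hq χ hprim hquad η hη hzero V X hVlo _hVhi hX
  -- basic positivity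
  have hq2 : (2 : ℝ) ≤ q := by exact_mod_cast hq
  have hq1 : (1 : ℝ) ≤ q := by linarith
  have hq0 : (0 : ℝ) < q := by linarith
  have hlogq : Real.log 2 ≤ Real.log q := Real.log_le_log two_pos hq2
  have hlogq0 : 0 < Real.log q := lt_of_lt_of_le hlog2 hlogq
  have hη0 : (0 : ℝ) < η := by linarith
  have hη1 : (1 : ℝ) ≤ η := by linarith
  set L : ℝ := Real.log η with hLdef
  have hL1 : 1 ≤ L := by
    rw [hLdef, Real.le_log_iff_exp_le hη0]
    linarith [Real.exp_one_lt_three]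
  have hL0 : 0 < L := by linarith
  have hV10 : 10 ≤ V := by
    have : (10 : ℝ) * 1 ≤ 10 * L := mul_le_mul_of_nonneg_left hL1 (by norm_num)
    linarith
  have hV0 : 0 < V := by linarith
  have hLV : L ≤ V := by linarith
  have hX1 : 1 ≤ X := by rw [hX]; exact Real.one_le_rpow hq1 hV0.le
  have hX0 : 0 < X := by linarith
  have hlogX : Real.log X = V * Real.log q := by rw [hX, Real.log_rpow hq0]
  -- `χ ≠ 1`, `χ² = 1`
  have hne : χ ≠ 1 := by
    intro h1
    have := (DirichletCharacter.eq_one_iff_conductor_eq_one (χ := χ)).mp h1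
    rw [hprim] at this
    omega
  -- Siegel: `η ≤ D q^{ε_S}`
  have hηD : η ≤ D * (q : ℝ) ^ εS := by
    have hS := hSiegel q χ hquad.sq_eq_one hne (1 - 1 / (η * Real.log q)) hzero
    have hS' : CS * (q : ℝ) ^ (-εS) ≤ 1 / (η * Real.log q) := by linarith
    have hpos : 0 < CS * (q : ℝ) ^ (-εS) := by positivity
    have hηlog : η * Real.log q ≤ (q : ℝ) ^ εS / CS := by
      have := (le_one_div hpos (by positivity)).mp hS'
      calc η * Real.log q ≤ 1 / (CS * (q : ℝ) ^ (-εS)) := this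
        _ = (q : ℝ) ^ εS / CS := by
            rw [Real.rpow_neg hq0.le]; field_simp
    calc η = η * Real.log q / Real.log q := by field_simp
      _ ≤ ((q : ℝ) ^ εS / CS) / Real.log q := by gcongr
      _ ≤ ((q : ℝ) ^ εS / CS) / Real.log 2 := by gcongr
      _ = D * (q : ℝ) ^ εS := by rw [hDdef]; field_simp
  -- hence `η ≤ D q^{1/4}` and `log η ≤ |log D| + ε_S log q`
  have hηD4 : η ≤ D * (q : ℝ) ^ (1 / 4 : ℝ) :=
    hηD.trans (mul_le_mul_of_nonneg_left (Real.rpow_le_rpow_of_exponent_le hq1 hεS4) hD.le)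
  have hLle : L ≤ M + εS * Real.log q := by
    calc L ≤ Real.log (D * (q : ℝ) ^ εS) := Real.log_le_log hη0 hηD
      _ = Real.log D + εS * Real.log q := by
          rw [Real.log_mul hD.ne' (Real.rpow_pos_of_pos hq0 εS).ne', Real.log_rpow hq0]
      _ ≤ M + εS * Real.log q := by linarith [le_abs_self (Real.log D)]
  -- consequence: `1/√q ≤ D²/η`
  have hsqrtq : 1 / Real.sqrt q ≤ D ^ 2 / η := by
    have hq14sq : ((q : ℝ) ^ (1 / 4 : ℝ)) ^ 2 = Real.sqrt q := by
      rw [← Real.rpow_natCast, ← Real.rpow_mul hq0.le, Real.sqrt_eq_rpow]; norm_num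
    have hη2 : η ^ 2 ≤ D ^ 2 * Real.sqrt q := by
      calc η ^ 2 ≤ (D * (q : ℝ) ^ (1 / 4 : ℝ)) ^ 2 := pow_le_pow_left₀ hη0.le hηD4 2
        _ = D ^ 2 * Real.sqrt q := by rw [mul_pow, hq14sq]
    rw [div_le_div_iff₀ (Real.sqrt_pos.mpr hq0) hη0, one_mul]
    exact (le_self_pow₀ hη1 two_ne_zero).trans hη2
  -- the target error `T = log⁶η / (η/V)` dominates `1/η`
  set T : ℝ := L ^ 6 / (η / V) with hTdef
  have hT' : T = V * L ^ 6 / η := by rw [hTdef, div_div_eq_mul_div]; ring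
  have hTη : 1 / η ≤ T := by
    rw [hT']
    refine div_le_div_of_nonneg_right ?_ hη0.le
    have hL6 : 1 ≤ L ^ 6 := one_le_pow₀ hL1
    exact one_le_mul_of_one_le_of_one_le (by linarith) hL6
  have hT0 : 0 < T := lt_of_lt_of_le (by positivity) hTη
  -- E1 = exp(−√(V log η)) ≤ 1/η
  have hE1 : Real.exp (-1 * Real.sqrt (V * L)) ≤ 1 / η := by
    rw [neg_one_mul, Real.exp_neg, one_div, inv_le_inv₀ (Real.exp_pos _) hη0]
    calc η = Real.exp L := (Real.exp_log hη0).symm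
      _ ≤ Real.exp (Real.sqrt (V * L)) := Real.exp_le_exp.mpr ?_
    calc L = Real.sqrt (L ^ 2) := (Real.sqrt_sq hL0.le).symm
      _ ≤ Real.sqrt (V * L) :=
          Real.sqrt_le_sqrt (by rw [pow_two]; exact mul_le_mul_of_nonneg_right hLV hL0.le)
  -- E2 = exp(−c₀ √log X) ≤ K₀/η
  have hE2 : Real.exp (-c₀ * Real.sqrt (Real.log X)) ≤ K₀ / η := by
    rw [hlogX]
    have hV' : 10 * Real.log η ≤ V := by rw [← hLdef]; exact hVlo
    exact MatomakiMerikoski.exp_neg_mul_sqrt_le_exp_div hc₀ hεSc hM hlogq0.le hη0 hLle hV'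
  have hE2' : K₀ / η ≤ K₀ * T := by
    rw [div_eq_mul_one_div]
    exact mul_le_mul_of_nonneg_left hTη hK₀.le
  -- the correction factor
  have hcorr := SiegelCorr.abs_corr_le (R := ℂ) χ hprim hquad hh
  have hcorr' : Real.sqrt (24 * h / q) ≤ Real.sqrt (24 * h) * D ^ 2 / η := by
    rw [Real.sqrt_div' _ hq0.le]
    calc Real.sqrt (24 * h) / Real.sqrt q = Real.sqrt (24 * h) * (1 / Real.sqrt q) := by ring
      _ ≤ Real.sqrt (24 * h) * (D ^ 2 / η) := by gcongr
      _ = Real.sqrt (24 * h) * D ^ 2 / η := by ring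
  have hcorrT : Real.sqrt (24 * h) * D ^ 2 / η ≤ Real.sqrt (24 * h) * D ^ 2 * T := by
    rw [div_eq_mul_one_div]
    exact mul_le_mul_of_nonneg_left hTη (by positivity)
  -- Theorem 1.3 (weak form)
  have hhX : (h : ℝ) ≤ h * X := le_mul_of_one_le_right hh0.le hX1
  have hmain := h13' q hq χ hprim hquad η hη hzero V X hV10 hX h hh hhX
  -- assemble
  set S : ℝ := ∑ n ∈ Icc 1 ⌊X⌋₊, Λ n * Λ (n + h) with hSdef
  set corr : ℝ := (if Nat.totient (2 ^ padicValNat 2 q) ∣ h then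
        (-1 : ℝ) ^ (h / Nat.totient (2 ^ padicValNat 2 q)) *
          ∏ p ∈ (q / 2 ^ padicValNat 2 q).primeFactors.filter (fun p => ¬ p ∣ h),
            (-1 : ℝ) / ((p : ℝ) - 2)
      else 0) with hcorrdef
  have htri : |S - X * G| ≤ |S - X * G * (1 + corr)| + |X * G * (1 + corr) - X * G| :=
    abs_sub_le _ _ _
  have hmid : |X * G * (1 + corr) - X * G| = X * |G| * |corr| := by
    rw [show X * G * (1 + corr) - X * G = X * G * corr by ring, abs_mul, abs_mul, abs_of_pos hX0]
  have hsum : Real.exp (-1 * Real.sqrt (V * L)) + Real.exp (-c₀ * Real.sqrt (Real.log X))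
      + V * L ^ 6 / η ≤ (2 + K₀ + D ^ 2) * T := by
    rw [← hT']
    have hD2T : 0 ≤ D ^ 2 * T := by positivity
    nlinarith [hE1, hTη, hE2, hE2', hD2T]
  have hc0 : 0 ≤ K₁ * ((h : ℝ) / (Nat.totient h : ℝ)) * X := by positivity
  calc |S - X * G| ≤ |S - X * G * (1 + corr)| + |X * G * (1 + corr) - X * G| := htri
    _ ≤ K₁ * ((h : ℝ) / (Nat.totient h : ℝ)) * X *
          (Real.exp (-1 * Real.sqrt (V * L)) + Real.exp (-c₀ * Real.sqrt (Real.log X))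
            + V * L ^ 6 / η) + X * |G| * |corr| := by
        rw [hmid]; exact add_le_add hmain le_rfl
    _ ≤ K₁ * ((h : ℝ) / (Nat.totient h : ℝ)) * X * ((2 + K₀ + D ^ 2) * T) +
          X * |G| * (Real.sqrt (24 * h) * D ^ 2 * T) := by
        gcongr
        · exact (hcorr.trans hcorr').trans hcorrT
    _ = (K₁ * ((h : ℝ) / (Nat.totient h : ℝ)) * (2 + K₀ + D ^ 2) + |G| * Real.sqrt (24 * h) * D ^ 2)
          * X * T := by ring
    _ = _ := by rw [hTdef]

/-- **Corollary 1.1(ii) from the CLASSICAL form of Theorem 1.3**, in exactly the shape of the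
hypothesis `h13` of `MatomakiMerikoski2023_fixedShift_of_pairCorrelation_classical`
(`SiegelZeroPrimePairsFixedShift.lean`, Corollary 1.1(i)): Theorem 1.3 for positive shifts
`h ≤ A X`, every `C ≥ 1`, with the second rate `exp(−c₀ √log X)` for a fixed absolute `c₀ > 0`
(what Lemma 2.4 with the classical zero-free region of `ζ` yields, `SiegelZeroPrimePairsLemma24.lean`).
Specialise `C = 1` and apply `MatomakiMerikoski2023_fixedShift_ii_of_weakPairCorrelation`.
[cite: MatomakiMerikoski2023, Corollary 1.1(ii) and its proof after Theorem 1.4] -/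
theorem MatomakiMerikoski2023_fixedShift_ii_of_pairCorrelation_classical {c₀ : ℝ} (hc₀ : 0 < c₀)
    (h13 : ∀ C : ℝ, 1 ≤ C → ∀ A : ℝ, 0 < A → ∃ K : ℝ, 0 < K ∧
      ∀ (q : ℕ) [NeZero q], 2 ≤ q → ∀ χ : DirichletCharacter ℂ q, χ.IsPrimitive → χ.IsQuadratic →
        ∀ η : ℝ, 10 ≤ η → χ.LFunction ((1 - 1 / (η * Real.log q) : ℝ) : ℂ) = 0 →
          ∀ V X : ℝ, 10 ≤ V → X = (q : ℝ) ^ V → ∀ h : ℕ, 1 ≤ h → (h : ℝ) ≤ A * X →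
            |(∑ n ∈ Icc 1 ⌊X⌋₊, Λ n * Λ (n + h)) -
                X * Literature.NumberTheory.Sieve.goldbachSingularSeries h *
                  (1 + if Nat.totient (2 ^ padicValNat 2 q) ∣ h then
                        (-1 : ℝ) ^ (h / Nat.totient (2 ^ padicValNat 2 q)) *
                          ∏ p ∈ (q / 2 ^ padicValNat 2 q).primeFactors.filter (fun p => ¬ p ∣ h),
                            (-1 : ℝ) / ((p : ℝ) - 2)
                      else 0)| ≤
              K * ((h : ℝ) / (Nat.totient h : ℝ)) * X *
                (Real.exp (-C * Real.sqrt (V * Real.log η)) +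
                  Real.exp (-c₀ * Real.sqrt (Real.log X)) +
                  V * Real.log η ^ (6 : ℕ) / η)) :
    MatomakiMerikoski2023_fixedShift_ii :=
  MatomakiMerikoski2023_fixedShift_ii_of_weakPairCorrelation hc₀ (fun A hA => h13 1 le_rfl A hA)

/-- **The vendored (Vinogradov–Korobov) Theorem 1.3 implies its weak form** with `c₀ = 1`:
take `C = 1`, `ε = 1/10`, so that `exp(−C (log X)^{3/5−ε}) = exp(−√log X)` (`log X ≥ 0` as
`X = q^V ≥ 1`). [cite: MatomakiMerikoski2023, Theorem 1.3] -/
theorem MatomakiMerikoski2023_pairCorrelation.weakPairCorrelation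
    (h13 : MatomakiMerikoski2023_pairCorrelation) :
    ∀ A : ℝ, 0 < A → ∃ K : ℝ, 0 < K ∧
      ∀ (q : ℕ) [NeZero q], 2 ≤ q → ∀ χ : DirichletCharacter ℂ q, χ.IsPrimitive → χ.IsQuadratic →
        ∀ η : ℝ, 10 ≤ η → χ.LFunction ((1 - 1 / (η * Real.log q) : ℝ) : ℂ) = 0 →
          ∀ V X : ℝ, 10 ≤ V → X = (q : ℝ) ^ V → ∀ h : ℕ, 1 ≤ h → (h : ℝ) ≤ A * X →
            |(∑ n ∈ Icc 1 ⌊X⌋₊, Λ n * Λ (n + h)) -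
                X * Literature.NumberTheory.Sieve.goldbachSingularSeries h *
                  (1 + if Nat.totient (2 ^ padicValNat 2 q) ∣ h then
                        (-1 : ℝ) ^ (h / Nat.totient (2 ^ padicValNat 2 q)) *
                          ∏ p ∈ (q / 2 ^ padicValNat 2 q).primeFactors.filter (fun p => ¬ p ∣ h),
                            (-1 : ℝ) / ((p : ℝ) - 2)
                      else 0)| ≤
              K * ((h : ℝ) / (Nat.totient h : ℝ)) * X *
                (Real.exp (-1 * Real.sqrt (V * Real.log η)) +
                  Real.exp (-1 * Real.sqrt (Real.log X)) +
                  V * Real.log η ^ (6 : ℕ) / η) := by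
  intro A hA
  obtain ⟨K, hK, H⟩ := h13 1 le_rfl (1 / 10) (by norm_num) A hA
  refine ⟨K, hK, fun q _ hq χ hprim hquad η hη hzero V X hV hX h hh hhA => ?_⟩
  have hmain := H q hq χ hprim hquad η hη hzero V X hV hX h hh hhA
  have hexp : (3 / 5 - 1 / 10 : ℝ) = 1 / 2 := by norm_num
  rwa [hexp, ← Real.sqrt_eq_rpow] at hmain

end Literature.Barriers.Parity

end
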